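import Literature.MathematicalPhysics.QuantumFieldTheory.Balaban1983to89.B3Op116MixedKernelRegularBox
import Literature.MathematicalPhysics.QuantumFieldTheory.Balaban1983to89.B3Op116CellBoxFaceFamily
import Literature.MathematicalPhysics.QuantumFieldTheory.Balaban1983to89.B3Ineq210MixedRegularBox

/-!
# `Balaban1983to89.B3Op116MixedKernelRegularCellBox` — T. Bałaban, *(Higgs)₂,₃ quantum fields in a finite volume. III. Renormalization*,
# Commun. Math. Phys. **88** (1983) 411–445 [Balaban1983Higgs3], (1.16) p. 414 / (2.5)–(2.6) p. 424 / (2.10) p. 426 / p. 433: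
# **THE MIXED ENTRY OF THE KERNEL OF (1.16) ON A CELL-PRODUCT BOX `□`, NO SUPPORT CLAUSE, AT INTERIOR POINTS** — the (C)-level plug of M2
# (`B3Op116MixedKernelRegularBox.kernel116_mixed_box_le`) on `Ω = □ = cellBox k K₀ S`: the per-piece (2.10) dictionaries of `G_k(□,B)` and
# `G_k(□,A+B)` are p35 g21's `B3Ineq210RegularBox.ineq210_regularBox_explicit_small` (values, differentiated columns) and
# `B3Ineq210MixedRegularBox.ineq210_mixed_regularBox` (twice-differentiated kernels), the face family and the heights of interior points are
# p35 g26's `B3Op116CellBoxFaceFamily` (file M3 = the binder `hM` of (2.5) for (1.16) on a box; p35 `DESIGN-FILE4.md` §19)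

statement-level skeleton of published theorems with citation tags; proofs where landed; nothing here is a claim about the Yang–Mills mass gap

PDFs held: `paper:balaban1983-higgs-2-3-quantum-fields-finite-volume` (journal page = PDF page + 410; p. 414 = `p0004.txt`, p. 424 = `p0014.txt`,
p. 426 = `p0016.txt`, p. 433 = `p0023.txt`); `paper:balaban1982-cmp85-higgs23-i` (p. 610 = `p0008.txt`, p. 611 = `p0009.txt`).

CITATION HEADER (lean-in-tree rule).  T. Bałaban, CMP **88** (1983) 411–445 [Balaban1983Higgs3]: (1.16) p. 414, (2.5)/(2.6) p. 424, (2.10) p. 426,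
p. 433; part I, CMP **85** (1982) 603–636 [Balaban1982Higgs1]: Prop. 2.1 (2.25) p. 610, p. 611 l.1–2.  Cell `lit-balaban` (HOME
`run/shared/lean/pub/lit-balaban/`), Phase-2 proof seat **p35** gen 28 (literature-prover-lit-balaban-p35-g28-0; free-target protocol G.5-34(d), TAKING
HOME/STATUS.md, cc r15 / p40).  SKELETON rows **B3.Eq1.16** / **B3.Eq2.5** / **B3.Txt@433** / **B3.Prop1** (owner r15) — LOCATED MEMBER, no head claim:
file M3 of route γ′'s mixed member (GAPS.md G-B3-16.A1).  USED BY NAME, never restated: M2 `B3Op116MixedKernelRegularBox.kernel116_mixed_box_le` and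
its constants `mixCB`, `rateM`; M1 `B3Op116MixedSeedBox.{pcolO, pdcolO, pmixO, pcolO_le_all, pdcolO_le_all, pmixO_eq_mixedTermR}`; p35 g21
`B1Ineq225RegularBox.cellBox`, `B3Ineq210RegularBox.{cellBox_blockUnion, ineq210_regularBox_explicit_small}`, `B3Ineq210MixedRegularBox.ineq210_mixed_regularBox`; p35 g26
`B3Op116CellBoxFaceFamily.{faceFam, faceFam_level, exB_cover_cellBox, enB_cover_cellBox, height_faceFam, inside_of_interior, faces_height_of_interior}`;
r14's `B3Ineq210RegularRegion.Interior`; p33's `B3Op116OrderedPairs.mesh_rpow_zero_sub`, `B3Op116ScaleChains.rate_eq`.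

WHAT IS PRINTED (verbatim).  p. 414 [PDF 4]: *"for n, n′ sufficiently large, a kernel of the operator (1.16) is a sufficiently regular function of
both variables. More exactly the Hölder norms of the covariant derivatives of this kernel, the norms defined for example in the inequalities (I.2.24)
and (I.2.25) of Proposition I.2.1, are exponentially decaying with the distance of the arguments and are uniformly bounded by
O(1)(e(L^kε)^{1−α})^{n+n′}"*.  p. 433 [PDF 23]: *"we take a cube □ of size 3r(L^kε) and with □₁ in the center. We assume that □₁, □ are sums of
big blocks of the unit lattice. … we include the operators (1.16) … into the external fields"*.  [B1] Prop. 2.1 p. 610 (the `R₀`-restriction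
«dist({x,x′}, Ωᶜ) ≥ R₀» of (2.24)–(2.25)).

WHAT THIS FILE PROVES.  **`kernel116_mixed_cellBox_interior_le`**: for `d ≥ 1`, `L ≥ 2`, `a, m² > 0` there is `K₀,min` such that for every
`K₀ ≥ K₀,min` there are `t, δ₁ ∈ (0,1], C > 0, C_M ≥ 0` with: for every lattice (`L`, `d`, `K₀ ∣ M`), every `1 ≤ k ≤ K` with `3·half ≤ |T|_μ` and
`L^kε ≤ 1`, every cell-product box `□ = cellBox k K₀ S`, every pair of fields `A` (`sup|A| ≤ s`, (I.2.23)-regular everywhere with `δ_A`), `B` and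
`A + B` ((I.2.23)-regular on `□` with `L^kδ|e| ≤ t`), `(L^kε)|e|s ≤ 1`, every `n + n′ > d` and every two INTERIOR points `x`, `x′` of `□` (r14's
`Interior k K₀ □`): `ε^{−d}·(ε^{−1}·Σ_i‖(D^ε_B(1.16)^□_{n,n′}dip^B_{⟨x′,μ′⟩}e_i)(⟨x,μ⟩)‖) ≤ mixCB(n+n′)·#Ix·(L^kε)^{n+n′}((L^kε)^d)^{−1}·
e^{−(δ^M_{n+n′−1}/2)|x−x′|/L^k}` with M2's constants at `θ = 1`, `n_F = #faces(□)` — p40's binder `hM` of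
`B3Ineq25Op116Smooth.ineq25At_op116_smooth_of_bounds` on `Ω = □`, NO support clause on `A`.
HONEST SCOPE.  Constants explicit through M2's displayed `def`s, not optimized, and (through `n_F = #faces`) box-dependent exactly as M2's; the
decay rate degrades by `4L` per insertion; `d < n + n′` is print's «n, n′ sufficiently large»; the row bond's point and the dipole's point are interior
(one top block inside `□`, the `R₀`-restriction of Prop. I.2.1).  No `def`, no new named fact, no `sorry`; axioms standard.  Value = the (C)-level
assembly of a by-reference estimate of B3 on a box — NOT summit progress, nothing about the mass gap.
-/

noncomputable section

open scoped BigOperators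

namespace Literature.MathematicalPhysics.QuantumFieldTheory.Balaban1983to89.B3Op116MixedKernelRegularCellBox

open HiggsLattice (ChargeData ScalarField covDeriv)
open HiggsCovariancePos (Inside)
open B1Eq230FluctCov (Ix cb)
open B3Ineq210RegularRegion (Interior pieceR)
open B1TorusCubeCover (half)
open B1Ineq225RegularBox (cellBox)
open B3Ineq210RegularBox (cellBox_blockUnion ineq210_regularBox_explicit_small)
open B3Ineq210MixedRegularBox (ineq210_mixed_regularBox)
open B3Ineq210MixedRegularRegion (mixedTermR)
open B3Op116CollarBoxFaces (faces)
open B3Op116CellBoxFaceFamily (faceFam faceFam_level exB_cover_cellBox enB_cover_cellBox height_faceFam inside_of_interior faces_height_of_interior)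
open B3Op116MixedSeedBox (pcolO pdcolO pmixO pcolO_le_all pdcolO_le_all pmixO_eq_mixedTermR)
open B3Op116MixedKernelRegularBox (mixCB rateM kernel116_mixed_box_le)
open B3Eq116TwoSidedExpansion (op116)
open B3Ineq210MixedRegularTorus (dip onb)

variable {P : HiggsLattice.Params} {N : ℕ}

/-- **THE MIXED ENTRY OF THE KERNEL OF (1.16) ON A CELL-PRODUCT BOX AT INTERIOR POINTS, NO SUPPORT CLAUSE** (see the module docstring for the
quantifiers): M2's `kernel116_mixed_box_le` on `Ω = □`, its per-piece dictionaries supplied by p35 g21's box estimates, its face family and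
heights by p35 g26's `B3Op116CellBoxFaceFamily` (`θ = 1`, `K₀ ≥ 1`).
[cite: Balaban1983Higgs3, (1.16) p.414, (2.5) p.424, (2.10) p.426, p.433] [cite: Balaban1982Higgs1, Prop. 2.1 (2.25) p.610, p.611 l.1–2] -/
theorem kernel116_mixed_cellBox_interior_le (d L : ℕ) (hd : 1 ≤ d) (hL : 2 ≤ L) {a : ℝ} (ha : 0 < a) {msq : ℝ} (hmsq : 0 < msq) (N : ℕ)
    (C : ChargeData N) :
    ∃ K₀min : ℕ, ∀ K₀ : ℕ, K₀min ≤ K₀ → ∃ t δ₁ Cst CM : ℝ, 0 < t ∧ 0 < δ₁ ∧ δ₁ ≤ 1 ∧ 0 < Cst ∧ 0 ≤ CM ∧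
      ∀ (P : HiggsLattice.Params), 1 < P.L → P.d = d → P.L = L → K₀ ∣ P.M →
      ∀ {k : ℕ}, 1 ≤ k → k ≤ P.K → (∀ μ, 3 * half P k K₀ ≤ P.sitesPerDir 0 μ) → P.mesh k ≤ 1 →
      ∀ (S : Fin P.d → Finset ℕ) (A B : HiggsLattice.VecField P 0) {s δA δB δAB : ℝ}, 0 ≤ s → 0 ≤ δA → 0 ≤ δB → 0 ≤ δAB →
        (∀ b : HiggsLattice.PBond P 0, |A b| ≤ s) →
        (∀ (z : HiggsLattice.Site P 0) (μ ν : Fin P.d), |A ⟨z.shift ν, μ⟩ - A ⟨z, μ⟩| ≤ δA) →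
        (∀ z ∈ cellBox k K₀ S, ∀ μ ν : Fin P.d, |B ⟨z.shift ν, μ⟩ - B ⟨z, μ⟩| ≤ δB) → (P.L : ℝ) ^ k * δB * |C.e| ≤ t →
        (∀ z ∈ cellBox k K₀ S, ∀ μ ν : Fin P.d, |(A + B) ⟨z.shift ν, μ⟩ - (A + B) ⟨z, μ⟩| ≤ δAB) → (P.L : ℝ) ^ k * δAB * |C.e| ≤ t →
        P.mesh k * (|C.e| * s) ≤ 1 →
        ∀ (i₀ : Ix N) (n n' : ℕ), P.d < n + n' →
        ∀ (μ μ' : Fin P.d) (x x' : HiggsLattice.Site P 0), Interior k K₀ (cellBox k K₀ S) x → Interior k K₀ (cellBox k K₀ S) x' →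
          (P.mesh 0 ^ P.d)⁻¹ * ((P.mesh 0)⁻¹ *
              ∑ i : Ix N, ‖covDeriv C B (op116 C (cellBox k K₀ S) A B msq a k n n' (dip C B ⟨x', μ'⟩ (onb N i))) ⟨x, μ⟩‖)
            ≤ mixCB P N C k (faces k K₀ S).card a δ₁ Cst CM s δA 1 (n + n') * (Fintype.card (Ix N) : ℝ) * P.mesh k ^ (n + n') *
                (P.mesh k ^ P.d)⁻¹ *
              Real.exp (-(rateM P N C k (faces k K₀ S).card a δ₁ Cst CM s δA 1 (n + n' - 1) / 2 *
                ((HiggsLattice.Site.tdist x x' : ℝ) / (P.L : ℝ) ^ k))) := by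
  classical
  obtain ⟨K₁, h1⟩ := ineq210_regularBox_explicit_small d L hd hL ha hmsq N C
  obtain ⟨K₂, h2⟩ := ineq210_mixed_regularBox d L hd hL ha hmsq N C
  refine ⟨max (max K₁ K₂) 1, fun K₀ hK₀ => ?_⟩
  have hK₁ : K₁ ≤ K₀ := ((le_max_left _ _).trans (le_max_left _ _)).trans hK₀
  have hK₂ : K₂ ≤ K₀ := ((le_max_right _ _).trans (le_max_left _ _)).trans hK₀
  have hK₀1 : 1 ≤ K₀ := (le_max_right _ _).trans hK₀
  obtain ⟨t₁, δa, Ca, ht₁, hδa, hCa, h1⟩ := h1 K₀ hK₁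
  obtain ⟨t₂, δm, Cm, ht₂, hδm, hCm, h2⟩ := h2 K₀ hK₂
  -- the common rate (cut at 1) and the two constants
  set δ₁ : ℝ := min (min δa δm) 1 with hδ₁def
  have hδ₁pos : 0 < δ₁ := lt_min (lt_min hδa hδm) one_pos
  have hδ₁1 : δ₁ ≤ 1 := min_le_right _ _
  have hδ₁a : δ₁ ≤ δa := (min_le_left _ _).trans (min_le_left _ _)
  have hδ₁m : δ₁ ≤ δm := (min_le_left _ _).trans (min_le_right _ _)
  refine ⟨min t₁ t₂, δ₁, Ca, Cm, lt_min ht₁ ht₂, hδ₁pos, hδ₁1, hCa, hCm.le, ?_⟩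
  intro P hP1 hPd hPL hK₀M k hk1 hkK h3 hmesh S A B s δA δB δAB hs hδA hδB hδAB hA hregA hregB htB hregAB htAB ht1 i₀ n n' hdn μ μ' x x' hx hx'
  set Ω := cellBox k K₀ S with hΩdef
  have hΩ : ∀ l, l ≤ k → ∀ x x' : HiggsLattice.Site P 0, HiggsAveraging.blockIter l x = HiggsAveraging.blockIter l x' → (x ∈ Ω ↔ x' ∈ Ω) :=
    fun l hl => cellBox_blockUnion hl S
  have hεd : 0 < P.mesh 0 ^ P.d := pow_pos (P.mesh_pos 0) _
  have hc : 0 ≤ P.mesh 0 ^ P.d * Ca := by positivity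
  have hdist : ∀ (j : ℕ) (x y : HiggsLattice.Site P 0), 0 ≤ (P.mesh j)⁻¹ * (P.mesh 0 * (HiggsLattice.Site.tdist x y : ℝ)) :=
    fun j x y => mul_nonneg (inv_nonneg.mpr (P.mesh_pos j).le) (mul_nonneg (P.mesh_pos 0).le (Nat.cast_nonneg _))
  have htB₁ : (P.L : ℝ) ^ k * δB * |C.e| ≤ t₁ := htB.trans (min_le_left _ _)
  have htB₂ : (P.L : ℝ) ^ k * δB * |C.e| ≤ t₂ := htB.trans (min_le_right _ _)
  have htAB₁ : (P.L : ℝ) ^ k * δAB * |C.e| ≤ t₁ := htAB.trans (min_le_left _ _)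
  have htAB₂ : (P.L : ℝ) ^ k * δAB * |C.e| ≤ t₂ := htAB.trans (min_le_right _ _)
  -- the per-piece dictionaries of one field `X` ((I.2.23)-regular on `□` with `L^kδ|e| ≤ t`)
  have hdict : ∀ (X : HiggsLattice.VecField P 0) {δX : ℝ}, 0 ≤ δX →
      (∀ z ∈ Ω, ∀ μ ν : Fin P.d, |X ⟨z.shift ν, μ⟩ - X ⟨z, μ⟩| ≤ δX) → (P.L : ℝ) ^ k * δX * |C.e| ≤ t₁ → (P.L : ℝ) ^ k * δX * |C.e| ≤ t₂ →
      (∀ (j : ℕ) (x : HiggsLattice.Site P 0), x ∈ Ω → ∀ y : HiggsLattice.Site P 0,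
        pcolO C Ω msq a k j X x y ≤ (P.mesh 0 ^ P.d * Ca) * P.mesh j ^ ((2 : ℝ) - (P.d : ℝ)) *
          Real.exp (-(δ₁ * (P.mesh j)⁻¹ * (P.mesh 0 * (HiggsLattice.Site.tdist x y : ℝ))))) ∧
      (∀ (j : ℕ) (b : HiggsLattice.PBond P 0), Inside Ω b → ∀ y : HiggsLattice.Site P 0,
        pdcolO C Ω msq a k j X X b y ≤ (P.mesh 0 ^ P.d * Ca) * P.mesh j ^ ((1 : ℝ) - (P.d : ℝ)) *
          Real.exp (-(δ₁ * (P.mesh j)⁻¹ * (P.mesh 0 * (HiggsLattice.Site.tdist b.src y : ℝ))))) ∧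
      (∀ (j : ℕ) (b₀ b : HiggsLattice.PBond P 0), Inside Ω b₀ → Inside Ω b →
        pmixO C Ω msq a k j X X b₀ b ≤ (P.mesh 0 ^ P.d * Cm) * P.mesh j ^ ((0 : ℝ) - (P.d : ℝ)) *
          Real.exp (-(δ₁ * (P.mesh j)⁻¹ * (P.mesh 0 * (HiggsLattice.Site.tdist b₀.src b.src : ℝ))))) := by
    intro X δX hδX hregX htX₁ htX₂
    have hX := fun j x y hx hy => h1 P hP1 hPd hPL hK₀M hk1 hkK h3 hmesh S X hδX hregX htX₁ j x y hx hy
    refine ⟨fun j x hx y => ?_, fun j b hb y => ?_, fun j b₀ b hb₀ hb => ?_⟩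
    · refine pcolO_le_all C Ω X hmsq ha hP1 hk1 hkK hΩ j hc (fun x hx y hy => ?_) hx y
      have h : pcolO C Ω msq a k j X x y ≤ P.mesh 0 ^ P.d * (Ca * P.mesh j ^ ((2 : ℝ) - (P.d : ℝ)) *
          Real.exp (-(δa * (P.mesh j)⁻¹ * (P.mesh 0 * (HiggsLattice.Site.tdist x y : ℝ))))) := (inv_mul_le_iff₀ hεd).1 (hX j x y hx hy).1
      refine h.trans ?_
      rw [mul_assoc δa, mul_assoc δ₁]
      calc P.mesh 0 ^ P.d * (Ca * P.mesh j ^ ((2 : ℝ) - (P.d : ℝ)) *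
            Real.exp (-(δa * ((P.mesh j)⁻¹ * (P.mesh 0 * (HiggsLattice.Site.tdist x y : ℝ))))))
          ≤ P.mesh 0 ^ P.d * (Ca * P.mesh j ^ ((2 : ℝ) - (P.d : ℝ)) *
            Real.exp (-(δ₁ * ((P.mesh j)⁻¹ * (P.mesh 0 * (HiggsLattice.Site.tdist x y : ℝ)))))) :=
            mul_le_mul_of_nonneg_left (mul_le_mul_of_nonneg_left (Real.exp_le_exp.mpr (by nlinarith [hdist j x y]))
              (mul_nonneg hCa.le (Real.rpow_nonneg (P.mesh_pos j).le _))) hεd.le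
        _ = _ := by ring
    · refine pdcolO_le_all C Ω X hmsq ha hP1 hk1 hkK hΩ X j hc (fun b hb y hy => ?_) hb y
      have h : pdcolO C Ω msq a k j X X b y ≤ P.mesh 0 ^ P.d * (Ca * P.mesh j ^ ((1 : ℝ) - (P.d : ℝ)) *
          Real.exp (-(δa * (P.mesh j)⁻¹ * (P.mesh 0 * (HiggsLattice.Site.tdist b.src y : ℝ))))) :=
        (inv_mul_le_iff₀ hεd).1 ((hX j b.src y hb.1 hy).2 b.dir hb.2)
      refine h.trans ?_
      rw [mul_assoc δa, mul_assoc δ₁]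
      calc P.mesh 0 ^ P.d * (Ca * P.mesh j ^ ((1 : ℝ) - (P.d : ℝ)) *
            Real.exp (-(δa * ((P.mesh j)⁻¹ * (P.mesh 0 * (HiggsLattice.Site.tdist b.src y : ℝ))))))
          ≤ P.mesh 0 ^ P.d * (Ca * P.mesh j ^ ((1 : ℝ) - (P.d : ℝ)) *
            Real.exp (-(δ₁ * ((P.mesh j)⁻¹ * (P.mesh 0 * (HiggsLattice.Site.tdist b.src y : ℝ)))))) :=
            mul_le_mul_of_nonneg_left (mul_le_mul_of_nonneg_left (Real.exp_le_exp.mpr (by nlinarith [hdist j b.src y]))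
              (mul_nonneg hCa.le (Real.rpow_nonneg (P.mesh_pos j).le _))) hεd.le
        _ = _ := by ring
    · have h := h2 P hPd hPL hK₀M hk1 hkK h3 hmesh S X hδX hregX htX₂ j b₀.dir b.dir b₀.src b.src hb₀.1 hb₀.2 hb.1 hb.2
      rw [pmixO_eq_mixedTermR, B3Op116OrderedPairs.mesh_rpow_zero_sub, B3Op116ScaleChains.rate_eq]
      calc P.mesh 0 ^ P.d * mixedTermR C Ω X msq a k j b₀.dir b.dir b₀.src b.src
          ≤ P.mesh 0 ^ P.d * (Cm * (P.mesh j ^ P.d)⁻¹ *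
              Real.exp (-(δm * ((HiggsLattice.Site.tdist b₀.src b.src : ℝ) / (P.L : ℝ) ^ j)))) :=
            mul_le_mul_of_nonneg_left h hεd.le
        _ ≤ P.mesh 0 ^ P.d * (Cm * (P.mesh j ^ P.d)⁻¹ *
              Real.exp (-(δ₁ / (P.L : ℝ) ^ j * (HiggsLattice.Site.tdist b₀.src b.src : ℝ)))) := by
            refine mul_le_mul_of_nonneg_left (mul_le_mul_of_nonneg_left ?_ ?_) hεd.le
            · rw [show δm * ((HiggsLattice.Site.tdist b₀.src b.src : ℝ) / (P.L : ℝ) ^ j)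
                  = δm * ((HiggsLattice.Site.tdist b₀.src b.src : ℝ) / (P.L : ℝ) ^ j) by rfl,
                show δ₁ / (P.L : ℝ) ^ j * (HiggsLattice.Site.tdist b₀.src b.src : ℝ)
                  = δ₁ * ((HiggsLattice.Site.tdist b₀.src b.src : ℝ) / (P.L : ℝ) ^ j) by ring]
              have hq : 0 ≤ (HiggsLattice.Site.tdist b₀.src b.src : ℝ) / (P.L : ℝ) ^ j := by have := P.hL; positivity
              exact Real.exp_le_exp.mpr (by nlinarith)
            · exact mul_nonneg hCm.le (inv_nonneg.mpr (pow_nonneg (P.mesh_pos j).le _))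
        _ = _ := by ring
  obtain ⟨hpcB, hpdB, hpmB⟩ := hdict B hδB hregB htB₁ htB₂
  obtain ⟨hpcAB, hpdAB, hpmAB⟩ := hdict (A + B) hδAB hregAB htAB₁ htAB₂
  exact kernel116_mixed_box_le hmsq ha hP1 hk1 hkK hΩ hδ₁pos hδ₁1 hCa.le hCm.le hs hδA ht1 hpcB hpdB hpmB hpcAB hpdAB hpmAB hA hregA i₀
    (faceFam_level k K₀ S) (exB_cover_cellBox k K₀ S A) (enB_cover_cellBox k K₀ S A) one_pos n n' hdn μ μ' x x'
    (inside_of_interior hx μ) (inside_of_interior hx' μ') (height_faceFam k K₀ S (faces_height_of_interior hK₀1 hx))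
    (height_faceFam k K₀ S (faces_height_of_interior hK₀1 hx'))

end Literature.MathematicalPhysics.QuantumFieldTheory.Balaban1983to89.B3Op116MixedKernelRegularCellBox

end
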